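import Summits.ABC.IUTFork.Joshi.ArithHolStructure
import HarnessLib

/-!
# [J-I] §3.3 / §4: the MULTIPLICATIVE TILT `K♭ = lim_{x ↦ x^p} K` of an untilt, concretely, and Prop. 4.1.7 (1)'s
# «same value groups as that of F» DISCHARGED from it (p431050's claim-def `SameValueGroup` becomes a theorem)

Companion (abc-iut cell, block E, rung LADDER-ABC:A2.E; seat abc-iut-E-t10, slot T-46) of `Joshi/ArithHolStructure.lean` (p431050),
whose reading note (e) recorded that the isometry «with an isometry `K♭ ≃ F`» ([J-I] arXiv:2106.11452v4 §3.5 p.9 l.38–40; the tilt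
`K♭` itself is §3.3 p.9 l.31–33) was carried by a POSITED multiplicative isometric map `sharp : F →*₀ K` («`y ↦ (ι⁻¹ y)^♯`»). Here
the `K`-side of that datum is made CONCRETE and
instance-free: the multiplicative monoid `K♭ := lim_{x ↦ x^p} K` of `p`-POWER-COMPATIBLE SEQUENCES `(x_n)_n`, `x_{n+1}^p = x_n`, in `K`
(the standard description of the tilt as a multiplicative monoid, [Scholze 2012, Lem. 3.4 (i)]; Joshi §3.3 cites exactly that lemma),
as a `Submonoid (ℕ → K)` — `powerCompatSeq U`; `x ↦ x^♯ = x_0` is the projection. A tilt identification «`K♭ ≃ F`» read on this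
monoid is `TiltMonoidDatum U F`: a multiplicative map `flat : F → K♭ ⊂ (ℕ → K)` ONTO the compatible sequences, isometric in degree 0
(`‖(flat y)_0‖_K = ‖y‖_F`, i.e. `|y|_F = |y^♯|_K`). No instance is declared; no FACT-LIST row is consumed; nothing of Joshi's is
asserted (the datum is a structure = hypothesis on its fields). TAKES NO SIDE on [IUTchIII] Cor. 3.12 or on any author; typed ≠
proved ≠ endorsed.

WHAT IS PROVED. (1) `sharpHom T : F →*₀ K`, `y ↦ (flat y)_0`, IS a monoid-with-zero hom and an isometry (`norm_sharpHom`) — so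
p431050's posited pair (`sharp`, `norm_sharp`) is CONSTRUCTIBLE from the monoid datum (`toSharp`), discharging half of reading note
(e). (2) **`range_norm_eq_of_tiltMonoidDatum`**: for an untilt `K` (algebraically closed, E-t1's `Untilt`) carrying a tilt-monoid
datum over `F`, THE VALUE SETS COINCIDE, `{‖a‖ : a ∈ K} = {‖y‖ : y ∈ F}` — PROVED: `⊇` by the isometry; `⊆` because every `a ∈ K`
heads a compatible sequence `(a, a^{1/p}, a^{1/p²}, …)` (algebraic closedness, Mathlib `IsAlgClosed.exists_pow_nat_eq`, assembled by
recursion), which is `flat y` for some `y` by surjectivity, whence `‖a‖ = ‖y‖`. Hence (3) **`sameValueGroup_of_tiltMonoidDatum`**: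
p431050's claim-def `ArithHolStructure.SameValueGroup S` ([J-I] Prop. 4.1.7 (1), p.19 l.29–30 «the same value groups as that of
F»; the hinge of Rmk. 4.2.1 (1) «compute arithmetic degrees in one fixed location namely the value group of F even as the untilt
moves») HOLDS for every arithmetic holomorphic structure whose untilt carries such a datum — Joshi's clause DISCHARGED modulo
«`K♭ ≅ lim_{x↦x^p} K` onto» (the definition of the tilt's multiplicative structure), our kernel check, not an endorsement.
Remaining merge-debt M-t10-1 (agreement of `flat`/`sharp` with Mathlib's `PreTilt.untilt ∘ ι⁻¹` on `𝒪_F`) is unchanged: `PreTilt`'s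
ring structure needs the instance `Fact (¬ IsUnit (p : 𝒪_K))`, available inside proofs only.

REVISION r1 (referee E-ref-3 defect D2 on the parent p431050, 2026-08-26T09:24:08Z): DOCSTRING-ONLY — every declaration is
byte-identical to p433682. The isometry clause is [J-I] §3.5 p.9 l.38–40, verbatim «with an isometry K♭ ≃ F»; §3.3 p.9 l.31–33 is the
tilt `K♭` (citing [Scholze 2012, Lem. 3.4]). Re-addressed above and in the docstring of `TiltMonoidDatum`; content unchanged.
-/

noncomputable section

namespace Summit.ABC.IUTFork.Joshi.ATS1

open Summit.ABC.IUTFork.Joshi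

variable {p : ℕ} [Fact p.Prime]

/-! ## `K♭` as the multiplicative monoid of `p`-power-compatible sequences -/

/-- **`lim_{x ↦ x^p} K`**: the `p`-power-compatible sequences `(x_n)_{n ∈ ℕ}` in `K`, `x_{n+1}^p = x_n`, a submonoid of `ℕ → K`
(pointwise multiplication) — the multiplicative monoid underlying the tilt `K♭` ([Scholze 2012, Lem. 3.4 (i)], as cited in [J-I] §3.3
p.9 l.31–33; cf. E-t25's `univCover` for `Ĝ_m`, [J-I] (10.6.2)). [folklore] -/
def powerCompatSeq (U : Untilt p) : Submonoid (ℕ → U.K) where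
  carrier := {x | ∀ n, x (n + 1) ^ p = x n}
  one_mem' := fun n => by simp
  mul_mem' {x y} hx hy := fun n => by rw [Pi.mul_apply, Pi.mul_apply, mul_pow, hx n, hy n]

/-- `x ↦ x^♯ := x_0`, the untilting projection `lim_{x ↦ x^p} K → K` (multiplicative). [folklore] -/
def sharpSeq (U : Untilt p) : (ℕ → U.K) →* U.K := Pi.evalMonoidHom (fun _ => U.K) 0

/-- Norms along a compatible sequence: `‖x_{n+1}‖^p = ‖x_n‖`. [folklore] -/
theorem norm_succ_pow {U : Untilt p} {x : ℕ → U.K} (hx : x ∈ powerCompatSeq U) (n : ℕ) :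
    ‖x (n + 1)‖ ^ p = ‖x n‖ := by
  rw [← norm_pow, hx n]

/-- Every element of an (algebraically closed) untilt heads a `p`-power-compatible sequence `(a, a^{1/p}, a^{1/p²}, …)`: the
projection `x ↦ x_0` is ONTO `K`. PROVED (Mathlib `IsAlgClosed.exists_pow_nat_eq`, recursion). [folklore] -/
theorem exists_powerCompatSeq_head (U : Untilt p) (a : U.K) : ∃ x ∈ powerCompatSeq U, x 0 = a := by
  have hp : 0 < p := (Fact.out : p.Prime).pos
  let step : U.K → U.K := fun b => Classical.choose (IsAlgClosed.exists_pow_nat_eq b hp)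
  have hstep : ∀ b, step b ^ p = b := fun b => Classical.choose_spec (IsAlgClosed.exists_pow_nat_eq b hp)
  refine ⟨fun n => Nat.rec a (fun _ b => step b) n, fun n => ?_, rfl⟩
  exact hstep _

/-! ## The tilt identification read on the monoid: `TiltMonoidDatum` -/

/-- **The tilting datum `K♭ ≃ F` read multiplicatively** ([J-I] §3.5 p.9 l.38–40 «with an isometry K♭ ≃ F»; Def. 4.1.1 (1)): a
multiplicative map `flat : F → lim_{x ↦ x^p} K` («`y ↦ ((ι⁻¹ y)^{♯ 1/pⁿ})_n`») that is ONTO the compatible sequences and ISOMETRIC in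
degree `0` (`‖(flat y)_0‖_K = ‖y‖_F`, i.e. `|·|_{K♭} = |(·)^♯|_K` transported to `F`). SIGNATURE (hypothesis on its fields; injectivity and
additivity of the tilt are not needed below and not recorded). [claim: Joshi2021ATS1, status: disputed] -/
structure TiltMonoidDatum (U : Untilt p) (F : Type) [NormedField F] : Type where
  /-- `y ↦ (y^{♯, 1/pⁿ})_n` -/
  flat : F → (ℕ → U.K)
  /-- values are `p`-power compatible -/
  flat_mem : ∀ y, flat y ∈ powerCompatSeq U
  /-- multiplicative -/
  flat_mul : ∀ y y', flat (y * y') = flat y * flat y'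
  /-- ONTO `lim_{x ↦ x^p} K` ([Scholze 2012, Lem. 3.4 (i)]: `K♭ ≅ lim K` multiplicatively) -/
  flat_surj : ∀ x ∈ powerCompatSeq U, ∃ y, flat y = x
  /-- isometric: `‖y^♯‖_K = ‖y‖_F` -/
  norm_flat : ∀ y, ‖flat y 0‖ = ‖y‖

namespace TiltMonoidDatum

variable {U : Untilt p} {F : Type} [NormedField F] (T : TiltMonoidDatum U F)

/-- `(flat 0)_0 = 0` (isometry). PROVED. [folklore] -/
theorem flat_zero_head : T.flat 0 0 = 0 := by
  have h := T.norm_flat 0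
  rw [norm_zero, norm_eq_zero] at h
  exact h

/-- `(flat 1)_0 = 1` (it is an idempotent of norm `1`). PROVED. [folklore] -/
theorem flat_one_head : T.flat 1 0 = 1 := by
  have hmul : T.flat 1 0 * T.flat 1 0 = T.flat 1 0 := by
    have := congrFun (T.flat_mul 1 1) 0
    rw [mul_one, Pi.mul_apply] at this
    exact this.symm
  have hne : T.flat 1 0 ≠ 0 := by
    intro h0
    have h := T.norm_flat 1
    rw [h0, norm_zero, norm_one] at h
    exact zero_ne_one h
  have : T.flat 1 0 * (T.flat 1 0 - 1) = 0 := by rw [mul_sub, mul_one, hmul, sub_self]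
  rcases mul_eq_zero.1 this with h | h
  · exact absurd h hne
  · exact sub_eq_zero.1 h

/-- **`y ↦ y^♯`** as a monoid-with-zero hom `F →*₀ K`, DERIVED from the monoid datum — the posited `sharp` of p431050 made
constructible. [claim: Joshi2021ATS1, status: disputed] -/
def sharpHom : F →*₀ U.K where
  toFun y := T.flat y 0
  map_zero' := T.flat_zero_head
  map_one' := T.flat_one_head
  map_mul' y y' := by rw [T.flat_mul]; rfl

/-- `‖y^♯‖_K = ‖y‖_F`. [folklore] -/
theorem norm_sharpHom (y : F) : ‖T.sharpHom y‖ = ‖y‖ := T.norm_flat y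

/-- **Prop. 4.1.7 (1), value groups, over the monoid datum**: the value sets of `K` and `F` COINCIDE — `⊇` by isometry, `⊆` because
`x ↦ x_0` is onto `K` (`exists_powerCompatSeq_head`, algebraic closedness) and `flat` is onto the compatible sequences. PROVED.
[claim: Joshi2021ATS1, status: disputed] -/
theorem range_norm_eq (T : TiltMonoidDatum U F) : Set.range (fun a : U.K => ‖a‖) = Set.range (fun y : F => ‖y‖) := by
  refine Set.Subset.antisymm ?_ ?_
  · rintro _ ⟨a, rfl⟩
    obtain ⟨x, hx, hx0⟩ := exists_powerCompatSeq_head U a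
    obtain ⟨y, hy⟩ := T.flat_surj x hx
    exact ⟨y, show ‖y‖ = ‖a‖ by rw [← T.norm_flat y, hy, hx0]⟩
  · rintro _ ⟨y, rfl⟩
    exact ⟨T.flat y 0, T.norm_flat y⟩

end TiltMonoidDatum

/-! ## Consequences for p431050's `ArithHolStructure` -/

namespace ArithHolStructure

variable {X : Literature.AnabelianGeometry.SemiGraphs.TemperedCurve p} {A : BerkovichDatum X} {F : Type} [NormedField F]
  [CompleteSpace F] [IsUltrametricDist F] [IsAlgClosed F] [CharP F p]

/-- **[J-I] Prop. 4.1.7 (1) «… the same value groups as that of F» DISCHARGED** modulo the multiplicative tilt datum: for an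
arithmetic holomorphic structure `S` whose untilt carries a `TiltMonoidDatum` over `F`, p431050's claim-def `SameValueGroup S`
HOLDS (the Prop depends on `S` only through `K = S.U.K` and `F`). Our kernel check of the typed clause; not an endorsement of the
preprint. [claim: Joshi2021ATS1, status: disputed] -/
theorem sameValueGroup_of_tiltMonoidDatum (S : ArithHolStructure X A F) (T : TiltMonoidDatum S.U F) : S.SameValueGroup :=
  T.range_norm_eq

/-- The degree-`0` isometry of a tilt-monoid datum supplies the `sharp`/`norm_sharp` fields of an arithmetic holomorphic structure:
from `(U, emb, ι, T, ∗_K)` one assembles an `ArithHolStructure` whose `sharp` is `T.sharpHom` (reading note (e) of p431050, half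
discharged: the posited pair is constructible). [claim: Joshi2021ATS1, status: disputed] -/
def ofTiltMonoidDatum (U : Untilt p) (emb : X.K →+* U.K) (h : Continuous fun x : ℚ_[p] => emb (algebraMap ℚ_[p] X.K x))
    (ι : tilt U ≃+* F) (T : TiltMonoidDatum U F) (b : A.BasePt U emb) : ArithHolStructure X A F :=
  ⟨U, emb, h, ι, T.sharpHom, T.norm_sharpHom, b⟩

/-- … and for structures so assembled `SameValueGroup` holds outright. [claim: Joshi2021ATS1, status: disputed] -/
theorem sameValueGroup_ofTiltMonoidDatum (U : Untilt p) (emb : X.K →+* U.K)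
    (h : Continuous fun x : ℚ_[p] => emb (algebraMap ℚ_[p] X.K x)) (ι : tilt U ≃+* F) (T : TiltMonoidDatum U F)
    (b : A.BasePt U emb) : (ofTiltMonoidDatum U emb h ι T b).SameValueGroup :=
  sameValueGroup_of_tiltMonoidDatum _ T

end ArithHolStructure

/-! ## Functoriality of the multiplicative tilt; isomorphisms «of the data» compatible with the tilting datum
(appended: closes reading note (a) of p431050 at the monoid level — Mathlib's `Tilt` has no functoriality in field isomorphisms,
but `lim_{x ↦ x^p} K` is functorial in ANY ring isomorphism, coordinatewise) -/

/-- A field isomorphism `φ : K ≃ K′` of untilts acts coordinatewise on sequences, `(x_n) ↦ (φ x_n)`. [folklore] -/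
def seqMap {U U' : Untilt p} (φ : U.K ≃+* U'.K) : (ℕ → U.K) →* (ℕ → U'.K) where
  toFun x n := φ (x n)
  map_one' := funext fun n => by simp
  map_mul' x y := funext fun n => by simp

/-- … and carries `p`-power-compatible sequences to `p`-power-compatible sequences: the multiplicative tilt `K ↦ lim_{x↦x^p} K` is
FUNCTORIAL in ring isomorphisms (what «morphisms of the data (K ⊃ E, K♭ ≃ F)», Def. 4.1.1 p.18 l.20–22, needs on the tilt side).
PROVED. [folklore] -/
theorem seqMap_mem {U U' : Untilt p} (φ : U.K ≃+* U'.K) {x : ℕ → U.K} (hx : x ∈ powerCompatSeq U) :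
    seqMap φ x ∈ powerCompatSeq U' := fun n => by
  change φ (x (n + 1)) ^ p = φ (x n)
  rw [← map_pow, hx n]

/-- `(φ x)^♯ = φ (x^♯)`. [folklore] -/
theorem sharpSeq_seqMap {U U' : Untilt p} (φ : U.K ≃+* U'.K) (x : ℕ → U.K) :
    sharpSeq U' (seqMap φ x) = φ (sharpSeq U x) := rfl

namespace ArithHolStructure

variable {X : Literature.AnabelianGeometry.SemiGraphs.TemperedCurve p} {A : BerkovichDatum X} {F : Type} [NormedField F]
  [CompleteSpace F] [IsUltrametricDist F] [IsAlgClosed F] [CharP F p]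

/-- **Isomorphisms of arithmetic holomorphic structures COMPATIBLE WITH THE TILTING DATA, read on the multiplicative tilt**
(Def. 4.1.1 «morphisms … of the data (X/E, (K ⊃ E, K♭ ≃ F), ∗_K)», p.18 l.20–22): p431050's `Iso` (topological iso of untilts +
embeddings + base points) TOGETHER WITH the commutation of the two tilt identifications `flat, flat′ : F → lim K, lim K′` through the
induced map of tilts `seqMap φ` — the component p431050's reading note (a) could not record over Mathlib's `Tilt`. [claim: Joshi2021ATS1, status: disputed] -/
structure IsoFlat (S S' : ArithHolStructure X A F) (T : TiltMonoidDatum S.U F) (T' : TiltMonoidDatum S'.U F) : Type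
    extends Iso S S' where
  /-- `flat′ = (φ)_♭ ∘ flat`: the tilt identifications correspond under the induced map of tilts -/
  flat_comm : ∀ y : F, T'.flat y = seqMap fieldEquiv.toRingEquiv (T.flat y)

/-- Under a tilt-compatible isomorphism the untilting maps correspond: `φ (y^♯) = y^{♯′}` — so the «degree computed in `F`» (Rmk.
4.2.1 (1)) is read consistently on both structures through `φ`. PROVED. [claim: Joshi2021ATS1, status: disputed] -/
theorem IsoFlat.sharpHom_comm {S S' : ArithHolStructure X A F} {T : TiltMonoidDatum S.U F} {T' : TiltMonoidDatum S'.U F}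
    (e : IsoFlat S S' T T') (y : F) : T'.sharpHom y = e.fieldEquiv.toRingEquiv (T.sharpHom y) := by
  change T'.flat y 0 = e.fieldEquiv.toRingEquiv (T.flat y 0)
  rw [e.flat_comm y]
  rfl

/-- … hence a tilt-compatible isomorphism is an ISOMETRY on the image of `♯` (`‖φ(y^♯)‖ = ‖y‖ = ‖y^♯‖`), although p431050's `Iso` only
asked `φ` to be a homeomorphism: the tilting data rigidify the norms on `F^♯ ⊂ K`. PROVED. [folklore] -/
theorem IsoFlat.norm_map_sharpHom {S S' : ArithHolStructure X A F} {T : TiltMonoidDatum S.U F} {T' : TiltMonoidDatum S'.U F}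
    (e : IsoFlat S S' T T') (y : F) : ‖e.fieldEquiv.toRingEquiv (T.sharpHom y)‖ = ‖T.sharpHom y‖ := by
  rw [← e.sharpHom_comm, T'.norm_sharpHom, T.norm_sharpHom]

end ArithHolStructure

end Summit.ABC.IUTFork.Joshi.ATS1

end
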